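import Summits.Ventures.GridStability.Lyapunov.WSCC9LossySlabDual33Data
import Summits.Ventures.GridStability.Lyapunov.WSCC9LossySlabDual
import Summits.Ventures.GridStability.Lyapunov.StructurePreservingLevelBound
import Summits.Ventures.GridStability.Lyapunov.WSCC9LossySlabRoa
import HarnessLib

/-!
# Rider «#74′ γ₀ = 2·arctan(33/500)» to ★ #74 «G2.c-WSCC9-LOSSY-SLAB-DUAL» — the typed slab/Popov class
# is EMPTY from 7.552° on (file 2 of 2; TOOLCHAIN B's witness, second kernel lineage of the dual side)

**OBSTRUCTION rider beside ★ #35 / ★ #74** for `M′ = WSCC9.lurieSystem` (Pai's directed machine-reference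
form of the printed lossy Kron-reduced 9-bus with non-uniform damping, `Models/ClassicalSwingLurie.lean`)
at the window `γ₀ = 2·arctan(33/500)` (≈ 7.552°; #74's was `2·arctan(7/100) ≈ 8.008°`):
`D : SlabDualWitness WSCC9.lurieSystem a0 b0` is toolchain B's exact dual witness (gridfusion-sos-2,
`cert/B/dual/ceiling/WSCC9LOSSY-slabdual-u660o10000-B-witness.json`, sha256 prefix `c472a722ab8d41a3`,
kit j276976) in lit-6's receptacle (`LuriePostnikovSlabDualWitness.lean`: `Z ⪰ 0`, (D1) `W + Wᵀ ⪰ 0` for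
the TRUE irrational input matrix via the centre form on lane V's weight box, (D2)–(D4)), every field
from the kernel decisions of file 1 (`WSCC9LossySlabDual33Data.lean`) by cast identities;
`no_slabCertificate_at` / `no_slabCertificate` / `slabClass_empty` / `no_slabCertificate_perChannel` —
**no** `Λ : SlabCertificate WSCC9.lurieSystem` satisfies the sector hypothesis `hsec` of lit-6's ROA
theorem for any window (function) `≥ 2·arctan(33/500)` on the six active channels (the window is written
as this LITERAL in the statements); `classCeiling_bracket` — NON-EMPTY at ★ #35's `2·arctan(13/200)`,
EMPTY from `2·arctan(33/500)`; `γ₀_le` (`≤ 33/250` rad); `γ₀_lt_dual74` (strictly below #74's window).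

THREE COLUMNS (lead RULING 6a).  CERTIFIED: «no slab certificate of the typed class (`SlabCertificate` +
`hsec`) certifies a slab half-width `≥ 2·arctan(33/500)` (≈ 7.552°) for `M′`; with ★ #35 the class
optimum lies in `(2·arctan(13/200), 2·arctan(33/500)]` ≈ `(7.438°, 7.552°]` — ★ #35's lane V is within
0.114° of optimal FOR ITS CLASS».  VALIDATED (floats, sos-2 kits j276802 / j276976): B's float dual margin
changes sign between `u₀ = 0.0656` and `0.0658` (optimum ≈ 7.51°–7.53°); at `0.0658` only a vertex-form
exact witness exists (the centre-form relaxation of (D1) used here fails).  MODELLED: as #35 (object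
identity = lane V's `A_eq`, `C_eq`, `hB`, `hw`, by name).  The sentence is about the CERTIFICATE CLASS,
not about the region of attraction of `M′` or of any grid.  Boxes: L = this pair; B = the witness IS
toolchain B's object (producer sos-2), so the independent check is R1's own recompute; D = literals ==
witness JSON (model-4).
[cite: BoydVandenberghe2004, §5.9.4 (5.97)–(5.98), Example 5.14; Pai1981, §2.16 (2.63)–(2.64), §4.6 p. 117]
-/

noncomputable section

open Real Matrix
open Literature.Computation.Certificates
open Literature.MathematicalPhysics.PowerSystems
open Literature.MathematicalPhysics.PowerSystems.LyapunovFunctionFamily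
open Summit.Ventures.GridStability.Models
open Summit.Ventures.GridStability.Lyapunov.WSCC9LossySlab

namespace Summit.Ventures.GridStability.Lyapunov.WSCC9LossySlabDual33

/-! ### Cast plumbing (the parent files' copies are private) -/

/-- `(M + N) ↦ ℝ` (cast plumbing). -/ private theorem map_add' {m n : Type*} (M N : Matrix m n ℚ) :
    (M + N).map (Rat.cast : ℚ → ℝ) = M.map (Rat.cast : ℚ → ℝ) + N.map (Rat.cast : ℚ → ℝ) := by
  ext i k; simp
/-- `(M − N) ↦ ℝ` (cast plumbing). -/ private theorem map_sub' {m n : Type*} (M N : Matrix m n ℚ) :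
    (M - N).map (Rat.cast : ℚ → ℝ) = M.map (Rat.cast : ℚ → ℝ) - N.map (Rat.cast : ℚ → ℝ) := by
  ext i k; simp
/-- `(−M) ↦ ℝ` (cast plumbing). -/ private theorem map_neg' {m n : Type*} (M : Matrix m n ℚ) :
    (-M).map (Rat.cast : ℚ → ℝ) = -M.map (Rat.cast : ℚ → ℝ) := by
  ext i k; simp
/-- `(q • M) ↦ ℝ` (cast plumbing). -/ private theorem map_smul' {m n : Type*} (q : ℚ) (M : Matrix m n ℚ) :
    (q • M).map (Rat.cast : ℚ → ℝ) = ((q : ℚ) : ℝ) • M.map (Rat.cast : ℚ → ℝ) := by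
  ext i k; simp
/-- `(Σ_j M_j) ↦ ℝ` (cast plumbing). -/ private theorem map_sum' {m n : Type*} {J : Type*} (s : Finset J) (M : J → Matrix m n ℚ) :
    (∑ j ∈ s, M j).map (Rat.cast : ℚ → ℝ) = ∑ j ∈ s, (M j).map (Rat.cast : ℚ → ℝ) := by
  ext i k; simp [Matrix.sum_apply]
/-- `(M N) ↦ ℝ` (cast plumbing). -/ private theorem map_mul' {l m n : Type*} [Fintype m] (M : Matrix l m ℚ) (N : Matrix m n ℚ) :
    (M * N).map (Rat.cast : ℚ → ℝ) = M.map (Rat.cast : ℚ → ℝ) * N.map (Rat.cast : ℚ → ℝ) := by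
  ext i k; simp [Matrix.mul_apply]
/-- `Mᵀ ↦ ℝ` (cast plumbing). -/ private theorem map_transpose' {m n : Type*} (M : Matrix m n ℚ) :
    Mᵀ.map (Rat.cast : ℚ → ℝ) = (M.map (Rat.cast : ℚ → ℝ))ᵀ := by
  ext i k; simp

/-! ### The witness data over `ℝ` -/

/-- `Z₁₁ ↦ ℝ`. -/
def Z₁₁ : Matrix (Fin 3 ⊕ Fin 2) (Fin 3 ⊕ Fin 2) ℝ := Z11Q.map (Rat.cast : ℚ → ℝ)
/-- `Z₂₁ ↦ ℝ`. -/
def Z₂₁ : Matrix (Fin 3 × Fin 3) (Fin 3 ⊕ Fin 2) ℝ := Z21Q.map (Rat.cast : ℚ → ℝ)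
/-- `Z₂₂ ↦ ℝ`. -/
def Z₂₂ : Matrix (Fin 3 × Fin 3) (Fin 3 × Fin 3) ℝ := Z22Q.map (Rat.cast : ℚ → ℝ)
/-- The witness's INNER lower slopes over `ℝ`. -/
def a0 (k : Fin 3 × Fin 3) : ℝ := (a0K k : ℝ)
/-- The witness's INNER upper slopes over `ℝ`. -/
def b0 (k : Fin 3 × Fin 3) : ℝ := (b0K k : ℝ)
/-- The window `γ₀ = 2·arctan(33/500)` (≈ 7.552°). -/
def γ₀ : ℝ := 2 * Real.arctan ((u0Q : ℚ) : ℝ)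

/-- `γ₀` is the literal window `2·arctan(33/500)` of the rider's name. -/
theorem γ₀_eq : γ₀ = 2 * Real.arctan (33 / 500) := by
  unfold γ₀; norm_num [u0Q]

/-- `cos γ₀ = cg0Q` (cast form, feeds `hwin`). -/
private theorem cos_γ₀_cast : Real.cos γ₀ = ((cg0Q : ℚ) : ℝ) := by
  unfold γ₀ cg0Q
  rw [Lyapunov.StructurePreserving.cos_two_mul_arctan]
  push_cast
  ring

/-- `sin γ₀ = sg0Q` (cast form, feeds `hwin`). -/
private theorem sin_γ₀_cast : Real.sin γ₀ = ((sg0Q : ℚ) : ℝ) := by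
  unfold γ₀ sg0Q
  rw [Lyapunov.StructurePreserving.sin_two_mul_arctan]
  push_cast
  ring

/-- **`cos(2·arctan(33/500)) = 248911/251089`** (closed form of the window's cosine). -/
theorem cos_γ₀ : Real.cos (2 * Real.arctan (33 / 500)) = 248911 / 251089 := by
  rw [← γ₀_eq, cos_γ₀_cast]; norm_num [cg0Q, u0Q]

/-- **`sin(2·arctan(33/500)) = 33000/251089`** (closed form of the window's sine). -/
theorem sin_γ₀ : Real.sin (2 * Real.arctan (33 / 500)) = 33000 / 251089 := by
  rw [← γ₀_eq, sin_γ₀_cast]; norm_num [sg0Q, u0Q]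

/-- `0 ≤ γ₀ ≤ π/2`. -/
theorem γ₀_range : 0 ≤ γ₀ ∧ γ₀ ≤ π / 2 := by
  have hu : (0 : ℝ) ≤ ((u0Q : ℚ) : ℝ) := by exact_mod_cast u0Q_pos_lt.1.le
  have hu1 : ((u0Q : ℚ) : ℝ) < 1 := by exact_mod_cast u0Q_pos_lt.2
  exact ⟨Lyapunov.StructurePreserving.two_mul_arctan_nonneg hu,
    (Lyapunov.StructurePreserving.two_mul_arctan_lt_pi_div_two hu1).le⟩

/-- `γ₀ ≤ 33/250` rad (`arctan u ≤ u`): every window of at least `0.132 rad ≈ 7.563°` is covered. -/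
theorem γ₀_le : γ₀ ≤ 33 / 250 := by
  unfold γ₀
  have h : Real.arctan ((u0Q : ℚ) : ℝ) ≤ ((u0Q : ℚ) : ℝ) :=
    Lyapunov.StructurePreserving.arctan_le_self (by exact_mod_cast u0Q_pos_lt.1.le)
  have : ((u0Q : ℚ) : ℝ) = 33 / 500 := by norm_num [u0Q]
  linarith

/-! ### `Z ⪰ 0` over `ℝ` -/

/-- The receptacle's block matrix is `ZQ ↦ ℝ`. -/
theorem fromBlocks_eq : Matrix.fromBlocks Z₁₁ Z₂₁ᵀ Z₂₁ Z₂₂ = ZQ.map (Rat.cast : ℚ → ℝ) := by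
  rw [ZQ, Matrix.fromBlocks_map, Z₁₁, Z₂₁, Z₂₂, map_transpose']

/-- **`Z ⪰ 0`.** -/
theorem psd : (Matrix.fromBlocks Z₁₁ Z₂₁ᵀ Z₂₁ Z₂₂).PosSemidef := by
  rw [fromBlocks_eq]
  have h := (ZQ_ldl.posSemidef (R := ℝ)).submatrix e2
  have e : ((ZQ.submatrix ⇑e2.symm ⇑e2.symm).map (Rat.cast : ℚ → ℝ)).submatrix e2 e2
      = ZQ.map (Rat.cast : ℚ → ℝ) := by
    ext i j; simp
  rwa [e] at h

/-! ### (D1): `W + Wᵀ ⪰ 0` for the TRUE input matrix, by the centre form on lane V's weight box -/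

/-- `G₀ ↦ ℝ`, `G_j ↦ ℝ`. -/
def G₀ : Matrix (Fin 3 ⊕ Fin 2) (Fin 3 ⊕ Fin 2) ℝ := G0Q.map (Rat.cast : ℚ → ℝ)
/-- `G_j ↦ ℝ`. -/
def G (j : Fin 6) : Matrix (Fin 3 ⊕ Fin 2) (Fin 3 ⊕ Fin 2) ℝ := (GjQ j).map (Rat.cast : ℚ → ℝ)

/-- `G_j` is symmetric. -/
theorem G_isHermitian (j : Fin 6) : (G j).IsHermitian := by
  show (G j)ᴴ = G j
  rw [Matrix.conjTranspose_eq_transpose_of_trivial, G, ← map_transpose', GjQ_transpose]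

/-- **The affine decomposition of `W + Wᵀ` in the weights**:
`dualAdjP M′ Z₁₁ Z₂₁ + (·)ᵀ = G₀ + Σ_j w_j • G_j` (from lane V's `A_eq`, `hB`, `Bj_eq`). -/
theorem adj_eq : dualAdjP WSCC9.lurieSystem Z₁₁ Z₂₁ + (dualAdjP WSCC9.lurieSystem Z₁₁ Z₂₁)ᵀ
    = G₀ + ∑ j, w j • G j := by
  have hBZ : WSCC9.lurieSystem.B * Z₂₁ = ∑ j, w j • (Bj j * Z₂₁) := by
    rw [hB, zero_add, Matrix.sum_mul]
    exact Finset.sum_congr rfl fun j _ => Matrix.smul_mul _ _ _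
  have hX : Z₁₁ * WSCC9.lurieSystem.Aᵀ + WSCC9.lurieSystem.A * Z₁₁
      = (Z11Q * AQᵀ + AQ * Z11Q).map (Rat.cast : ℚ → ℝ) := by
    rw [A_eq, Z₁₁, map_add', map_mul', map_mul', map_transpose']
  have hG : ∀ j, w j • G j = -((2 : ℝ) • (w j • (Bj j * Z₂₁))) - ((2 : ℝ) • (w j • (Bj j * Z₂₁)))ᵀ := by
    intro j
    rw [G, GjQ, map_neg', map_smul', map_add', map_transpose', map_mul', ← Bj_eq, Z₂₁,
      Matrix.transpose_smul, Matrix.transpose_smul]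
    simp only [smul_add, smul_neg, Rat.cast_ofNat, smul_comm (w j) (2 : ℝ)]
    abel
  rw [dualAdjP, hBZ, G₀, G0Q, map_add', map_transpose', ← hX]
  simp only [hG, Matrix.transpose_sub, Matrix.transpose_add, Matrix.transpose_smul,
    Matrix.transpose_sum, Finset.smul_sum, Finset.sum_sub_distrib, Finset.sum_neg_distrib]
  abel

/-- The centre-form matrix over `ℝ` is `HQ ↦ ℝ`. -/
theorem center_eq : G₀ + ∑ j, ctr j • G j - ∑ j, rad j • rowAbsDiag (G j)
    = HQ.map (Rat.cast : ℚ → ℝ) := by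
  rw [HQ, map_sub', map_add', map_sum', map_sum', G₀]
  congr 1
  · congr 1
    exact Finset.sum_congr rfl fun j _ => by rw [map_smul', ctr, G]
  · exact Finset.sum_congr rfl fun j _ => by rw [map_smul', rad, G, rowAbsDiag_map_ratCast]

/-- `H ⪰ 0` over `ℝ`. -/
theorem center_psd : (G₀ + ∑ j, ctr j • G j - ∑ j, rad j • rowAbsDiag (G j)).PosSemidef := by
  rw [center_eq]
  have h := (HQ_ldl.posSemidef (R := ℝ)).submatrix e1
  have e : ((HQ.submatrix ⇑e1.symm ⇑e1.symm).map (Rat.cast : ℚ → ℝ)).submatrix e1 e1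
      = HQ.map (Rat.cast : ℚ → ℝ) := by
    ext i j; simp
  rwa [e] at h

/-- **(D1)** `W + Wᵀ ⪰ 0` for the true (irrational) input matrix of `M′`. -/
theorem adjP_psd :
    (dualAdjP WSCC9.lurieSystem Z₁₁ Z₂₁ + (dualAdjP WSCC9.lurieSystem Z₁₁ Z₂₁)ᵀ).PosSemidef := by
  rw [adj_eq]
  exact posSemidef_affine_of_center G₀ G G_isHermitian ctr rad center_psd w hw_center

/-! ### (D2)–(D4) and the null channels over `ℝ` -/

/-- The four dual functionals are the casts of `UQ`, `VQ`, `WQ`, `SQ`. -/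
theorem functionals_eq (k : Fin 3 × Fin 3) :
    (WSCC9.lurieSystem.C * Z₁₁ * WSCC9.lurieSystem.Cᵀ) k k = ((UQ k : ℚ) : ℝ) ∧
    (Z₂₁ * WSCC9.lurieSystem.Cᵀ) k k = ((VQ k : ℚ) : ℝ) ∧
    Z₂₂ k k = ((WQ k : ℚ) : ℝ) ∧
    dualPopovCoeff WSCC9.lurieSystem Z₂₁ Z₂₂ k = ((SQ k : ℚ) : ℝ) := by
  refine ⟨?_, ?_, ?_, ?_⟩
  · rw [C_eq, Z₁₁, ← map_transpose', ← map_mul', ← map_mul', Matrix.map_apply, UQ]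
  · rw [C_eq, Z₂₁, ← map_transpose', ← map_mul', Matrix.map_apply, VQ]
  · rw [Z₂₂, Matrix.map_apply, WQ]
  · rw [dualPopovCoeff, Matrix.mul_assoc, ← Matrix.mul_assoc WSCC9.lurieSystem.C, WSCC9LossySlabDual.C_mul_B,
      Matrix.zero_mul, Matrix.zero_apply, sub_zero, C_eq, A_eq, Z₂₁, ← map_mul', ← map_transpose',
      ← map_mul', Matrix.map_apply, SQ]

/-- **(D2)** at the witness slopes. -/
theorem sectorCoeff_nonneg (k : Fin 3 × Fin 3) :
    0 ≤ dualSectorCoeff WSCC9.lurieSystem Z₁₁ Z₂₁ Z₂₂ a0 b0 k := by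
  obtain ⟨hU, hV, hW, -⟩ := functionals_eq k
  rw [dualSectorCoeff, hU, hV, hW, a0, b0]
  exact_mod_cast (dual_tests k).1

/-- **(D3)** on the admissible channels. -/
theorem popovCoeff_nonneg (k : Fin 3 × Fin 3) (hk : 0 ≤ a0 k) :
    0 ≤ dualPopovCoeff WSCC9.lurieSystem Z₂₁ Z₂₂ k := by
  rw [(functionals_eq k).2.2.2]
  have hk' : 0 ≤ a0K k := by unfold a0 at hk; exact_mod_cast hk
  exact_mod_cast (dual_tests k).2.1 hk'

/-- **(D4a)** `a0 < b0`. -/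
theorem slope_lt (k : Fin 3 × Fin 3) : a0 k < b0 k := by
  unfold a0 b0; exact_mod_cast (dual_tests k).2.2.1

/-- **(D4b)** `tr Z₁₁ > 0`. -/
theorem trace_pos : 0 < Matrix.trace Z₁₁ := by
  have h : Matrix.trace Z₁₁ = ((Matrix.trace Z11Q : ℚ) : ℝ) := by
    simp [Z₁₁, Matrix.trace, Rat.cast_sum]
  rw [h]; exact_mod_cast trace_test

/-- **TOOLCHAIN B's DUAL WITNESS** against the slab/Popov certificate class on `M′ = WSCC9.lurieSystem`
at B's inner slopes `(a0, b0)` of the window `γ₀ = 2·arctan(33/500)`.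
[cite: BoydVandenberghe2004, §5.9.4 (5.97)–(5.98), Example 5.14] -/
def D : SlabDualWitness WSCC9.lurieSystem a0 b0 where
  Z₁₁ := Z₁₁
  Z₂₁ := Z₂₁
  Z₂₂ := Z₂₂
  psd := psd
  adjP_psd := adjP_psd
  sectorCoeff_nonneg := sectorCoeff_nonneg
  popovCoeff_nonneg := popovCoeff_nonneg
  slope_lt := slope_lt
  trace_pos := trace_pos

/-- The weightless diagonal channels are NULL for the witness. -/
theorem isNull_diag (k : Fin 3 × Fin 3) (hk : k.1 = k.2) : D.IsNull k := by
  obtain ⟨hU, hV, hW, hS⟩ := functionals_eq k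
  obtain ⟨h1, h2, h3, h4⟩ := (dual_tests k).2.2.2 hk
  refine ⟨?_, ?_, ?_, ?_⟩
  · show (WSCC9.lurieSystem.C * Z₁₁ * WSCC9.lurieSystem.Cᵀ) k k = 0; rw [hU]; exact_mod_cast h1
  · show (Z₂₁ * WSCC9.lurieSystem.Cᵀ) k k = 0; rw [hV]; exact_mod_cast h2
  · show Z₂₂ k k = 0; rw [hW]; exact_mod_cast h3
  · show dualPopovCoeff WSCC9.lurieSystem Z₂₁ Z₂₂ k = 0; rw [hS]; exact_mod_cast h4

/-! ### The window points of the active channels (lane V's exact channel data, by name) -/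

/-- **`hwin`**: every channel is NULL or has window points `ξa`, `ξb` in `|ξ − δ*_k| ≤ γ₀` with
`cos ξa ≤ a0_k`, `b0_k ≤ cos ξb` (the inner roundings decided in `window_tests`). -/
theorem hwin : ∀ k, D.IsNull k ∨
    ((∃ ξ, |ξ - WSCC9.lurieSystem.δs k| ≤ γ₀ ∧ Real.cos ξ ≤ a0 k) ∧
      ∃ ξ, |ξ - WSCC9.lurieSystem.δs k| ≤ γ₀ ∧ b0 k ≤ Real.cos ξ) := by
  intro k
  by_cases hk : k.1 = k.2
  · exact Or.inl (isNull_diag k hk)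
  right
  obtain ⟨ha0, hlo, hhi⟩ := window_tests k hk
  have hE := WSCC9.postB_SPdamp_eqData
  have hB : 0 < WSCC9.postB_SPdamp.toModel.B k.1 k.2 :=
    WSCC9.postB_SPdamp.toModel_B_pos WSCC9.postB_SPdamp_B_pos k.1 k.2 hk
  have hY : 0 < WSCC9.postB_SPdamp.toModel.Ypol k.1 k.2 := WSCC9.postB_SPdamp.toModel.Ypol_pos hB
  have hm : WSCC9.postB_SPdamp.toModel.Ypol k.1 k.2 *
      Real.cos (WSCC9.postB_SPdamp.angleOf k.1 - WSCC9.postB_SPdamp.angleOf k.2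
        + WSCC9.postB_SPdamp.toModel.θpol k.1 k.2)
        = ((WSCC9.postB_SPdamp.dirMarginB k.1 k.2 : ℚ) : ℝ) := by
    rw [WSCC9.postB_SPdamp.toModel.Ypol_mul_cos_add hB, WSCC9.postB_SPdamp.dirMarginB_cast hE]
  have hn : WSCC9.postB_SPdamp.toModel.Ypol k.1 k.2 *
      Real.sin (WSCC9.postB_SPdamp.angleOf k.1 - WSCC9.postB_SPdamp.angleOf k.2
        + WSCC9.postB_SPdamp.toModel.θpol k.1 k.2)
        = ((WSCC9.postB_SPdamp.dirSinB k.1 k.2 : ℚ) : ℝ) := by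
    rw [WSCC9.postB_SPdamp.toModel.Ypol_mul_sin_add hB, WSCC9.postB_SPdamp.dirSinB_cast hE]
  have hδ := WSCC9.postB_SPdamp_channelShift_abs_lt k
  have hY2 : WSCC9.postB_SPdamp.toModel.Ypol k.1 k.2 ^ 2 = ((WSCC9.postB_SPdamp.Ysq k.1 k.2 : ℚ) : ℝ) :=
    WSCC9.postB_SPdamp.Ypol_sq_cast k.1 k.2
  have hδs : WSCC9.lurieSystem.δs k
      = WSCC9.postB_SPdamp.angleOf k.1 - WSCC9.postB_SPdamp.angleOf k.2
        + WSCC9.postB_SPdamp.toModel.θpol k.1 k.2 := rfl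
  rw [hδs]
  constructor
  · refine exists_window_point_cos_le (a₀ := a0 k) hY hm hn cos_γ₀_cast sin_γ₀_cast γ₀_range.1 ?_ ?_
    · unfold a0; exact_mod_cast ha0
    · rcases hlo with h | h
      · left; exact_mod_cast h
      · right; unfold a0; rw [hY2]; exact_mod_cast h
  · refine exists_window_point_le_cos (b₀ := b0 k) hY hm hn cos_γ₀_cast sin_γ₀_cast γ₀_range.1 ?_
    rcases hhi with ⟨h1, h2, h3⟩ | ⟨h4, h5⟩
    · left
      refine ⟨by unfold b0; exact_mod_cast h1, ?_, by linarith [γ₀_range.2, Real.pi_pos],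
        by exact_mod_cast h2, by rw [hY2]; exact_mod_cast h3⟩
      have : |InternalNode.channelShift WSCC9.postB_SPdamp.toModel.θpol WSCC9.postB_SPdamp.angleOf k|
          = |WSCC9.postB_SPdamp.angleOf k.1 - WSCC9.postB_SPdamp.angleOf k.2
              + WSCC9.postB_SPdamp.toModel.θpol k.1 k.2| := rfl
      linarith [hδ, Real.pi_pos]
    · right
      refine ⟨by exact_mod_cast h4, ?_⟩
      rcases h5 with h | h
      · left; unfold b0; exact_mod_cast h
      · right; unfold b0; rw [hY2]; exact_mod_cast h

/-! ### THE THEOREM -/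

/-- **No slab certificate at the window `γ₀`.**  No `Λ : SlabCertificate WSCC9.lurieSystem` satisfies
the sector hypothesis of lit-6's ROA theorem (`well_subset_regionOfAttraction`) on the window
`|ξ − δ*_k| ≤ γ₀ = 2·arctan(33/500)`: B's dual witness `D` refutes it (weak theorem of alternatives).
CERTIFIED sentence: the typed certificate class is EMPTY at `γ₀` — a statement about certificates,
not about trajectories of `M′`. [cite: BoydVandenberghe2004, §5.9.4 (5.97)–(5.98), Example 5.14] -/
theorem no_slabCertificate_at (Λ : SlabCertificate WSCC9.lurieSystem)
    (hsec : ∀ k ξ, |ξ - WSCC9.lurieSystem.δs k| ≤ 2 * Real.arctan (33 / 500) →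
      Λ.a k ≤ Real.cos ξ ∧ Real.cos ξ ≤ Λ.b k) :
    False := by
  rw [← γ₀_eq] at hsec
  exact Λ.false_of_dualWitness_of_exists_window D (γ := fun _ => γ₀) hsec hwin

/-- **No slab certificate at any window `γ ≥ γ₀`** (the sector hypothesis for `γ` implies it for `γ₀`). -/
theorem no_slabCertificate (Λ : SlabCertificate WSCC9.lurieSystem) {γ : ℝ}
    (hγ : 2 * Real.arctan (33 / 500) ≤ γ)
    (hsec : ∀ k ξ, |ξ - WSCC9.lurieSystem.δs k| ≤ γ → Λ.a k ≤ Real.cos ξ ∧ Real.cos ξ ≤ Λ.b k) :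
    False :=
  no_slabCertificate_at Λ fun k ξ hξ => hsec k ξ (hξ.trans hγ)

/-- **The class is empty from `γ₀` on** (set form): for every `γ ≥ 2·arctan(33/500)` there is NO slab
certificate of the typed class usable on the window `γ` — beside ★ #35's certificate at
`γ = 2·arctan(13/200)`, this pins the class optimum in `(2·arctan(13/200), 2·arctan(33/500)]`. -/
theorem slabClass_empty (γ : ℝ) (hγ : 2 * Real.arctan (33 / 500) ≤ γ) :
    ¬ ∃ Λ : SlabCertificate WSCC9.lurieSystem,
      ∀ k ξ, |ξ - WSCC9.lurieSystem.δs k| ≤ γ → Λ.a k ≤ Real.cos ξ ∧ Real.cos ξ ≤ Λ.b k :=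
  fun ⟨Λ, hsec⟩ => no_slabCertificate Λ hγ hsec

/-- **Per-channel windows** (ref-2 row 255 precision (1), as in #74): the refutation needs the window
only on the six ACTIVE channels and only `γ_k ≥ γ₀` there — for every window function `γ` with
`γ₀ ≤ γ_k` on the channels `p ≠ q` (anything on the weightless diagonal channels), no certificate of
the typed class satisfies the sector hypothesis. -/
theorem no_slabCertificate_perChannel (Λ : SlabCertificate WSCC9.lurieSystem) (γ : Fin 3 × Fin 3 → ℝ)
    (hγ : ∀ k : Fin 3 × Fin 3, k.1 ≠ k.2 → 2 * Real.arctan (33 / 500) ≤ γ k)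
    (hsec : ∀ k ξ, |ξ - WSCC9.lurieSystem.δs k| ≤ γ k → Λ.a k ≤ Real.cos ξ ∧ Real.cos ξ ≤ Λ.b k) :
    False := by
  simp only [← γ₀_eq] at hγ
  refine Λ.false_of_dualWitness_of_exists_window D (γ := γ) hsec fun k => ?_
  by_cases hk : k.1 = k.2
  · exact Or.inl (isNull_diag k hk)
  · rcases hwin k with h | ⟨⟨ξa, hξa, hca⟩, ξb, hξb, hcb⟩
    · exact Or.inl h
    · exact Or.inr ⟨⟨ξa, hξa.trans (hγ k hk), hca⟩, ξb, hξb.trans (hγ k hk), hcb⟩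

/-- **THE BRACKET** (one kernel object for the rider's sentence «class optimum ∈ (7.438°, 7.552°]», both
windows as literals): the typed class is NON-EMPTY at ★ #35's window `2·arctan(13/200)` (lane V's `cert`
with its `hsec`, `WSCC9LossySlabRoa`) and EMPTY at every window `≥ 2·arctan(33/500)` (this file). -/
theorem classCeiling_bracket :
    (∃ Λ : SlabCertificate WSCC9.lurieSystem,
      ∀ k ξ, |ξ - WSCC9.lurieSystem.δs k| ≤ 2 * Real.arctan (13 / 200) →
        Λ.a k ≤ Real.cos ξ ∧ Real.cos ξ ≤ Λ.b k) ∧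
    ∀ γ' : ℝ, 2 * Real.arctan (33 / 500) ≤ γ' → ¬ ∃ Λ : SlabCertificate WSCC9.lurieSystem,
      ∀ k ξ, |ξ - WSCC9.lurieSystem.δs k| ≤ γ' → Λ.a k ≤ Real.cos ξ ∧ Real.cos ξ ≤ Λ.b k := by
  refine ⟨⟨WSCC9LossySlab.cert, ?_⟩, slabClass_empty⟩
  have hγ : WSCC9LossySlab.γ = 2 * Real.arctan (13 / 200) := by
    unfold WSCC9LossySlab.γ; norm_num [uQ]
  rw [← hγ]
  exact WSCC9LossySlab.hsec

/-- The two windows of the bracket in closed form: `2·arctan(13/200) < 2·arctan(33/500)`. -/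
theorem γ_lt_γ₀ : WSCC9LossySlab.γ < γ₀ := by
  unfold WSCC9LossySlab.γ γ₀
  have h : ((uQ : ℚ) : ℝ) < ((u0Q : ℚ) : ℝ) := by norm_num [uQ, u0Q]
  have := Real.arctan_strictMono h
  linarith

/-- **This rider SHARPENS ★ #74**: its window is strictly below #74's, `2·arctan(33/500) < 2·arctan(7/100)`
(so #74's `slabClass_empty` is the special case `γ ≥ 2·arctan(7/100)` of this file's `slabClass_empty`). -/
theorem γ₀_lt_dual74 : γ₀ < WSCC9LossySlabDual.γ₀ := by
  unfold γ₀ WSCC9LossySlabDual.γ₀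
  have h : ((u0Q : ℚ) : ℝ) < ((WSCC9LossySlabDual.u0Q : ℚ) : ℝ) := by
    norm_num [u0Q, WSCC9LossySlabDual.u0Q]
  have := Real.arctan_strictMono h
  linarith

end Summit.Ventures.GridStability.Lyapunov.WSCC9LossySlabDual33

end
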